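import Summits.QuantumFields.YangMills.Theses.FemtoCutoffLadder
import Summits.QuantumFields.YangMills.Theorems.FemtoCutoffLadderUpStepEvGlue

/-!
# PinnedUpStep (stmt-QuantumFields-26925, crux r501 of route-QuantumFields-FemtoCutoffLadder; engine of UpStepEv 26796) — skeleton «conjuncts»
(planner ym-idea-1 g5, 2026-08-28; answers director-ym R435(b) «re-arm only when a seat-sized sub-piece is named BY SIGNATURE»)

Two registered stubs = the two conjuncts of the pinned variational step, cut so that the SEAT-SIZED one is universal:
* `stub_pinnedVarPos` (M; seat-sized; informative either way): for EVERY sub-octave pair `L' < L < 2L'`, all `β, β'`, every positive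
  normalised fine ground state `Ω`, every coarse ground state `Ω' ≥ c' > 0` and every normalised coarse excited eigenfunction `φ' ⊥ Ω'`,
  the pulled-back trial observable `fbar = avg_v (φ'/Ω') ∘ T ∘ τ_(−v)` is NOT `Ω²dμ`-a.e. constant: `⟨ψ,Ω⟩² < ⟨ψ,ψ⟩` for `ψ = fbar·Ω`.
  (Route to a proof: `φ' = λ₁'⁻¹ K'φ'` and `Ω'` are continuous (smoothing kernel), Haar product measure has full support, `T ∘ lift = id`
  (`Thinning.thin_thinLift`), so `fbar ∘ lift` is a non-trivial average of `φ'/Ω'`; a STUB-FALSE here (some admissible `φ'` with `fbar ≡ const`)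
  would force the critic's Pc revision `∀ φ' → ∃ φ'` — new item, never an in-place restate.)
* `stub_pinnedAutocorr` (XL; the analytic heart, eventual along the window like 26925 itself): the one-sided autocorrelation comparison
  `λ₁'^{L'} λ₀^L · Var_Ω(fbar) ≤ e^{CΛ²} λ₀'^{L'} · (⟨ψ, K^L ψ⟩ − λ₀^L ⟨ψ,Ω⟩²)`.
Composition `PinnedUpStep_of` is bookkeeping of the eventual quantifiers (kernel-checked below).  Honours Disproof/price record: C idle at any
fixed pair (p617135) — hence stub 1 is stated for ALL pairs and stub 2 keeps the `∃ L0` of record.  R2b1 record rung only — no summit.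
-/

namespace Summit.QuantumFields.YangMills.Cruxes.PinnedUpStep.Conjuncts

open Summit.QuantumFields.YangMills.Theses.FemtoCutoffLadder
open Summit.QuantumFields.YangMills.Theorems.FemtoTransferGap

/-- Sub-piece 1 (M, seat-sized): strict positivity of the trial variance, for EVERY sub-octave pair (no window, no `L0`). [cite: Luscher1983, §2] -/
def PinnedVarPos : Prop :=
  ∀ (L' : ℕ) [NeZero L'] (L : ℕ) [NeZero L], L' < L → L < 2 * L' → ∀ β β' : ℝ, ∀ Ω : Literature.MathematicalPhysics.QuantumFieldTheory.GaugeConfig 3 L SU2 → ℝ, IsPhys Ω → (∀ U, 0 < Ω U) → l2 Ω Ω = 1 → (∀ U, ∫ V, transferKernel su2Rep β U V * Ω V ∂(configMeasure SU2 L) = topValue su2Rep L β * Ω U) → ∀ Ω' : Literature.MathematicalPhysics.QuantumFieldTheory.GaugeConfig 3 L' SU2 → ℝ, IsPhys Ω' → ∀ c' : ℝ, 0 < c' → (∀ U', c' ≤ Ω' U') → l2 Ω' Ω' = 1 → (∀ U', ∫ V', transferKernel su2Rep β' U' V' * Ω' V' ∂(configMeasure SU2 L') = topValue su2Rep L' β'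 * Ω' U') → ∀ φ' : Literature.MathematicalPhysics.QuantumFieldTheory.GaugeConfig 3 L' SU2 → ℝ, IsPhys φ' → l2 φ' Ω' = 0 → l2 φ' φ' = 1 → (∀ U', ∫ V', transferKernel su2Rep β' U' V' * φ' V' ∂(configMeasure SU2 L') = secondValue su2Rep L' β' * φ' U') → let T : Literature.MathematicalPhysics.QuantumFieldTheory.GaugeConfig 3 L SU2 → Literature.MathematicalPhysics.QuantumFieldTheory.GaugeConfig 3 L' SU2 := fun U e' => (List.ofFn fun t : Fin (if (e'.1 e'.2).val < L - L' then 2 else 1) => U ((fun j => (((e'.1 j).val + min (e'.1 j).val (L - L') : ℕ) : ZMod L)) + Pi.single e'.2 ((t : ℕ) : ZMod L), e'.2)).prod; let fbar : Literature.MathematicalPhysics.QuantumFieldTheory.GaugeConfig 3 L SU2 → ℝ := fun U => (Fintype.card (Literature.MathematicalPhysics.QuantumFieldTheory.Site 3 L) : ℝ)⁻¹ * ∑ v : Literature.MathematicalPhysics.QuantumFieldTheory.Site 3 L, φ' (T fun e => U (e.1 - v, e.2)) / Ω' (T fun e => U (e.1 - v, e.2)); let ψ : Literature.MathematicalPhysics.QuantumFieldTheory.GaugeConfig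 3 L SU2 → ℝ := fun U => fbar U * Ω U; l2 ψ Ω ^ 2 < l2 ψ ψ

/-- Sub-piece 2 (XL): the one-sided autocorrelation comparison along the femto window (second conjunct of 26925, same eventual prefix).
[cite: Balaban1985Averaging, §1] [cite: Luscher1983, §3] -/
def PinnedAutocorr : Prop :=
  ∃ C lam0 : ℝ, 0 < lam0 ∧ ∀ lam : ℝ, 0 < lam → lam ≤ lam0 → ∃ L0 : ℕ, ∀ (L' : ℕ) [NeZero L'] (L : ℕ) [NeZero L], L0 ≤ L' → L' < L → L < 2 * L' → ∀ β β' : ℝ, InFemtoWindow lam β L → InFemtoWindow lam β' L' → luscherLambda β L = luscherLambda β' L' → ∀ Ω : Literature.MathematicalPhysics.QuantumFieldTheory.GaugeConfig 3 L SU2 → ℝ, IsPhys Ω → (∀ U, 0 < Ω U) → l2 Ω Ω = 1 → (∀ U, ∫ V, transferKernel su2Rep β U V * Ω V ∂(configMeasure SU2 L) = topValue su2Rep L β * Ω U) → ∀ Ω' : Literature.MathematicalPhysics.QuantumFieldTheory.GaugeConfig 3 L' SU2 → ℝ, IsPhys Ω' → ∀ c' : ℝ, 0 < c' → (∀ U',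 c' ≤ Ω' U') → l2 Ω' Ω' = 1 → (∀ U', ∫ V', transferKernel su2Rep β' U' V' * Ω' V' ∂(configMeasure SU2 L') = topValue su2Rep L' β' * Ω' U') → ∀ φ' : Literature.MathematicalPhysics.QuantumFieldTheory.GaugeConfig 3 L' SU2 → ℝ, IsPhys φ' → l2 φ' Ω' = 0 → l2 φ' φ' = 1 → (∀ U', ∫ V', transferKernel su2Rep β' U' V' * φ' V' ∂(configMeasure SU2 L') = secondValue su2Rep L' β' * φ' U') → let T : Literature.MathematicalPhysics.QuantumFieldTheory.GaugeConfig 3 L SU2 → Literature.MathematicalPhysics.QuantumFieldTheory.GaugeConfig 3 L' SU2 := fun U e' => (List.ofFn fun t : Fin (if (e'.1 e'.2).val < L - L' then 2 else 1) => U ((fun j => (((e'.1 j).val + min (e'.1 j).val (L - L') : ℕ) : ZMod L)) + Pi.single e'.2 ((t : ℕ) : ZMod L), e'.2)).prod; let fbar : Literature.MathematicalPhysics.QuantumFieldTheory.GaugeConfig 3 L SU2 → ℝ := fun U => (Fintype.card (Literature.MathematicalPhysics.QuantumFieldTheory.Site 3 L) : ℝ)⁻¹ * ∑ v : Literature.MathematicalPhysics.QuantumFieldTheory.Site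 3 L, φ' (T fun e => U (e.1 - v, e.2)) / Ω' (T fun e => U (e.1 - v, e.2)); let ψ : Literature.MathematicalPhysics.QuantumFieldTheory.GaugeConfig 3 L SU2 → ℝ := fun U => fbar U * Ω U; let K : (Literature.MathematicalPhysics.QuantumFieldTheory.GaugeConfig 3 L SU2 → ℝ) → (Literature.MathematicalPhysics.QuantumFieldTheory.GaugeConfig 3 L SU2 → ℝ) := fun χ U => ∫ V, transferKernel su2Rep β U V * χ V ∂(configMeasure SU2 L); secondValue su2Rep L' β' ^ L' * topValue su2Rep L β ^ L * (l2 ψ ψ - l2 ψ Ω ^ 2) ≤ Real.exp (C * luscherLambda β L ^ 2) * (topValue su2Rep L' β' ^ L' * (l2 ψ (K^[L] ψ) - topValue su2Rep L β ^ L * l2 ψ Ω ^ 2))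

/-- STUB 1 (M, seat-sized). -/
theorem stub_pinnedVarPos : PinnedVarPos := by
  sorry

/-- STUB 2 (XL). -/
theorem stub_pinnedAutocorr : PinnedAutocorr := by
  sorry

/-- Kernel-checked composition (tree pattern `…_holds_of_stubs`, no hypotheses): the two conjunct stubs give `PinnedUpStep` (26925) by name. -/
theorem PinnedUpStep_holds_of_stubs : PinnedUpStep := by
  have h1 : PinnedVarPos := stub_pinnedVarPos
  obtain ⟨C, lam0, hlam0, H⟩ := stub_pinnedAutocorr
  refine ⟨C, lam0, hlam0, fun lam hl hle => ?_⟩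
  obtain ⟨L0, H'⟩ := H lam hl hle
  refine ⟨L0, ?_⟩
  intro L' _ L _ hL0 hlt h2lt β β' hw hw' hΛ Ω hΩ hpos hn hE Ω' hΩ' c' hc' hlow hn' hE' φ' hφ' horth hn1 hE1
  exact ⟨h1 L' L hlt h2lt β β' Ω hΩ hpos hn hE Ω' hΩ' c' hc' hlow hn' hE' φ' hφ' horth hn1 hE1,
    H' L' L hL0 hlt h2lt β β' hw hw' hΛ Ω hΩ hpos hn hE Ω' hΩ' c' hc' hlow hn' hE' φ' hφ' horth hn1 hE1⟩

/-- … and UpStepEv (26796) from it by the landed engine glue (p616170). -/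
theorem upStepEv_holds_of_stubs : UpStepEv :=
  Summit.QuantumFields.YangMills.Theorems.FemtoCutoffLadder.upStepEv_of_pinnedUpStep PinnedUpStep_holds_of_stubs

end Summit.QuantumFields.YangMills.Cruxes.PinnedUpStep.Conjuncts
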